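import Literature.Topology.FourManifolds.RealProjectiveSpaceProofs
import Literature.AlgebraicTopology.SingularHomology.DoubleCoverTransfer
import Literature.AlgebraicTopology.SingularHomology.WuVanishingOfTube
import Literature.AlgebraicTopology.SingularHomology.CohomologyOfPoint
import Literature.AlgebraicTopology.SingularHomology.WuClasses
import Mathlib.Algebra.Field.ZMod
import HarnessLib

/-!
# `H*(ℝℙⁿ; 𝔽₂)` through the transfer sequence of `𝕊ⁿ → ℝℙⁿ`

A. Hatcher, *Algebraic Topology* (2002), Thm. 3.19: `H*(ℝℙⁿ; ℤ₂) ≈ ℤ₂[α]/(αⁿ⁺¹)`, `|α| = 1`;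
Example 1.43: `Sⁿ → ℝℙⁿ` is a two-sheeted covering; §2.B p. 174: the transfer sequence of a
two-sheeted covering; Cor. 2.14 (homology of spheres); Thm. 3.26 (top homology of a closed
connected manifold). J.-C. Hausmann, *Mod Two Homology and Cohomology* (2014), §4.3.3 and
Prop. 4.3.10: `H*(ℝPⁿ) = ℤ₂[a]/(aⁿ⁺¹)` from the transfer exact sequence, the connecting
homomorphism being the cup product with the characteristic class.

For the tree's real projective space `RealProjectiveSpace n` (the quotient of `𝕊ⁿ` by `±1`,
`RealProjectiveSpaceProofs.lean`) and `𝔽₂ = ZMod 2` coefficients this file PROVES, from the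
transfer machinery of `DoubleCoverTransfer.lean`:

* `antipodalCover n : TwoSheetedCover (𝕊 n) (RealProjectiveSpace n)` (projection `mk`, flip the
  antipode), `pathConnectedSpace`;
* `omega n ∈ H¹(ℝℙⁿ; 𝔽₂)` — the characteristic class — and `omegaPow n k = ωᵏ` (iterates of the
  connecting map `Δ`; `omegaPow_succ_eq_cupProduct : ωᵏ⁺¹ = ω ⌣ ωᵏ`);
* `transferMap_zero_apply` (`τ = 0` on `H⁰(𝕊ⁿ)`), `transferδ_injective` (`Δ` injective on `Hᵏ`,
  `k < n`), `transferδ_surjective` (`Δ` onto `Hᵏ⁺¹`, `k + 1 < n`) — from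
  `Hᵏ(𝕊ⁿ; 𝔽₂) = 0`, `0 < k < n` (`isZero_singularCohomology_sphere_of_field`) and the constancy of
  `0`-cocycles on path-connected spaces (`CohomologyOfPoint.lean`);
* **`eq_zero_or_eq_omegaPow`: `Hᵏ(ℝℙⁿ; 𝔽₂) = {0, ωᵏ}` for `k < n`**, and
  **`omegaPow_ne_zero`: `ωᵏ ≠ 0` for `k ≤ n`**;
* `exists_eq_smul_modTwoFundamentalClass`, `eq_zero_of_kroneckerPairing_modTwoFundamentalClass_eq_zero`
  (for every closed connected manifold: `Hₙ(X; 𝔽₂) = 𝔽₂·[X]₂` and the Kronecker pairing with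
  `[X]₂` detects `Hⁿ(X; 𝔽₂)`), whence **`kroneckerPairing_omegaPow_top_ne_zero`:
  `⟨ωⁿ, [ℝℙⁿ]₂⟩ ≠ 0`** (`n ≥ 1`).

No named facts. Written for the first Wu class of `ℝℙ⁴` (`BordismFourRealProjectiveFour.lean`), in
support of `Literature.Topology.FourManifolds.natCard_unorientedBordismClass_four`.

## References

* A. Hatcher, *Algebraic Topology*, CUP 2002, Example 1.43, §2.B p. 174, Cor. 2.14, Thm. 3.19,
  Thm. 3.26, §3.1 p. 199. [HatcherAT2002]
* J.-C. Hausmann, *Mod Two Homology and Cohomology*, Universitext, Springer 2014, §4.3.3,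
  Prop. 4.3.10. [Hausmann2014]
-/

noncomputable section

open scoped Manifold ContDiff Topology
open CategoryTheory Set Function Metric
open Literature.AlgebraicTopology.SingularHomology
open Literature.AlgebraicTopology.SingularHomology.singularCochainComplex

namespace Literature.Topology.FourManifolds

/-- Local notation: `𝔼 n` is the model Euclidean space `EuclideanSpace ℝ (Fin n)`. -/
local notation "𝔼 " n:arg => EuclideanSpace ℝ (Fin n)

/-- Local notation: `𝕊 n` is the unit sphere in `EuclideanSpace ℝ (Fin (n + 1))`. -/
local notation "𝕊 " n:arg => (Metric.sphere (0 : EuclideanSpace ℝ (Fin (n + 1))) 1)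

namespace RealProjectiveSpace

/-! ### The antipodal two-sheeted covering `𝕊ⁿ → ℝℙⁿ` -/

/-- **The antipodal double covering `𝕊ⁿ → ℝℙⁿ`** as a `TwoSheetedCover`: projection `mk`, deck
involution the antipode `x ↦ -x` (Hatcher 2002, Example 1.43: the quotient map `Sⁿ → ℝℙⁿ` is a
two-sheeted covering space). [cite: HatcherAT2002, Example 1.43] -/
def antipodalCover (n : ℕ) : TwoSheetedCover (𝕊 n) (RealProjectiveSpace n) where
  proj := ⟨mk n, (contMDiff_mk n).continuous⟩
  flip := ⟨fun x => -x, continuous_neg⟩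
  isCoveringMap_proj :=
    IsRealProjectiveSpace.isCoveringMap (isLocalDiffeomorph_mk n) (mk_surjective n) (mk_eq_mk_iff (n := n))
  surjective_proj := mk_surjective n
  proj_flip e := ((mk_eq_mk_iff e (-e)).2 (Or.inr rfl)).symm
  flip_ne e := (ne_neg_of_mem_unit_sphere ℝ e).symm
  eq_or_eq_flip h := (mk_eq_mk_iff _ _).1 h.symm

/-- `proj` of the antipodal cover is `mk`. [folklore] -/
@[simp] lemma antipodalCover_proj_apply (n : ℕ) (x : 𝕊 n) : (antipodalCover n).proj x = mk n x := rfl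

/-- `ℝℙⁿ` is path connected for `n ≥ 1` (continuous image of the path-connected sphere). [cite: HatcherAT2002, Example 1.43] -/
theorem pathConnectedSpace (n : ℕ) (hn : 1 ≤ n) : PathConnectedSpace (RealProjectiveSpace n) := by
  haveI : PathConnectedSpace (𝕊 n) := by
    rw [← isPathConnected_iff_pathConnectedSpace]
    refine isPathConnected_sphere ?_ 0 zero_le_one
    rw [← Module.finrank_eq_rank, finrank_euclideanSpace_fin]
    exact_mod_cast Nat.lt_succ_of_le hn
  exact (mk_surjective n).pathConnectedSpace (contMDiff_mk n).continuous

/-! ### The transfer sequence of `𝕊ⁿ → ℝℙⁿ` with `𝔽₂` coefficients -/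

section Transfer

variable (n : ℕ)

/-- **The generator `ω ∈ H¹(ℝℙⁿ; 𝔽₂)`**: the characteristic class of the antipodal double cover
(Hatcher 2002, §2.B p. 174 / Thm. 3.19). [cite: HatcherAT2002, Thm. 3.19 and §2.B p. 174] -/
def omega : singularCohomology (ZMod 2) (ZMod 2) (RealProjectiveSpace n) 1 :=
  (antipodalCover n).charClass

/-- The powers `ωᵏ ∈ Hᵏ(ℝℙⁿ; 𝔽₂)`, defined as iterates of the transfer connecting map
(`ωᵏ⁺¹ = Δ(ωᵏ) = ω ⌣ ωᵏ`, `omegaPow_succ_eq_cupProduct`). [cite: HatcherAT2002, Thm. 3.19] -/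
def omegaPow : (k : ℕ) → singularCohomology (ZMod 2) (ZMod 2) (RealProjectiveSpace n) k
  | 0 => singularCohomology.one (ZMod 2) (RealProjectiveSpace n)
  | k + 1 => (antipodalCover n).transferδ k (k + 1) rfl (omegaPow k)

/-- `ω⁰ = 1`. [folklore] -/
@[simp] lemma omegaPow_zero : omegaPow n 0 = singularCohomology.one (ZMod 2) (RealProjectiveSpace n) := rfl

/-- `ωᵏ⁺¹ = Δ(ωᵏ)`. [folklore] -/
lemma omegaPow_succ (k : ℕ) :
    omegaPow n (k + 1) = (antipodalCover n).transferδ k (k + 1) rfl (omegaPow n k) := rfl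

/-- `ω¹ = ω`. [folklore] -/
lemma omegaPow_one : omegaPow n 1 = omega n := rfl

/-- **`ωᵏ⁺¹ = ω ⌣ ωᵏ`** (the connecting map is cup product with `ω`). [cite: Hausmann2014, §4.3.3] -/
theorem omegaPow_succ_eq_cupProduct (k : ℕ) :
    omegaPow n (k + 1) = cupProduct (Nat.add_comm 1 k) (omega n) (omegaPow n k) :=
  (antipodalCover n).transferδ_eq_charClass_cupProduct _

/-- **The transfer vanishes on `H⁰(𝕊ⁿ; 𝔽₂)`** (`n ≥ 1`): a `0`-cocycle on the path-connected
sphere is constant, and `c + c = 0` in `𝔽₂`. [cite: HatcherAT2002, §2.B p. 174] -/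
theorem transferMap_zero_apply (hn : 1 ≤ n) (x : singularCohomology (ZMod 2) (ZMod 2) (𝕊 n) 0) :
    (antipodalCover n).transferMap 0 x = 0 := by
  haveI : PathConnectedSpace (𝕊 n) := by
    rw [← isPathConnected_iff_pathConnectedSpace]
    refine isPathConnected_sphere ?_ 0 zero_le_one
    rw [← Module.finrank_eq_rank, finrank_euclideanSpace_fin]
    exact_mod_cast Nat.lt_succ_of_le hn
  induction x using singularCohomology_induction_on with
  | h u =>
  change ((singularCochainComplex (ZMod 2) (ZMod 2) (𝕊 n)).homologyπ 0 ≫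
    HomologicalComplex.homologyMap (antipodalCover n).transfer 0) u = 0
  rw [HomologicalComplex.homologyπ_naturality, ModuleCat.comp_apply]
  have hz : HomologicalComplex.cyclesMap (antipodalCover n).transfer 0 u =
      (0 : cocycles (ZMod 2) (ZMod 2) (RealProjectiveSpace n) 0) := by
    refine coFn_injective (R := ZMod 2) (X := RealProjectiveSpace n) (p := 0) ?_
    rw [coFn_zero (R := ZMod 2) (X := RealProjectiveSpace n) (p := 0), coFn_eq, ← ModuleCat.comp_apply,
      HomologicalComplex.cyclesMap_i, ModuleCat.comp_apply]
    funext σ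
    have hconst := singularCochainComplex.apply_eq_of_d_eq_zero (R := ZMod 2) (M := ZMod 2) (X := 𝕊 n)
      (coFn u) (coboundary_coFn u)
    change (antipodalCover n).transferCochain 0 (coFn u) σ = 0
    rw [TwoSheetedCover.transferCochain_apply, TwoSheetedCover.pairSum,
      hconst (((antipodalCover n).someLift σ).map (antipodalCover n).flip) ((antipodalCover n).someLift σ)]
    exact add_self_of_charTwo (R := ZMod 2) (coFn u ((antipodalCover n).someLift σ))
  change singularCohomology.π (ZMod 2) (ZMod 2) (RealProjectiveSpace n) 0 _ = 0
  rw [hz, map_zero]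

/-- **`Δ : Hᵏ(ℝℙⁿ) → Hᵏ⁺¹(ℝℙⁿ)` is injective for `k < n`** (`n ≥ 1`): its kernel is the image of
the transfer `Hᵏ(𝕊ⁿ) → Hᵏ(ℝℙⁿ)`, which vanishes (`Hᵏ(𝕊ⁿ; 𝔽₂) = 0` for `0 < k < n`, and
`transferMap_zero_apply` for `k = 0`). [cite: HatcherAT2002, §2.B p. 174 and Cor. 2.14] -/
theorem transferδ_injective (hn : 1 ≤ n) {k : ℕ} (hk : k < n) :
    Function.Injective ((antipodalCover n).transferδ (R := ZMod 2) k (k + 1) rfl) := by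
  haveI : Fact (Nat.Prime 2) := ⟨Nat.prime_two⟩
  rw [injective_iff_map_eq_zero]
  intro x hx
  obtain ⟨y, rfl⟩ := (ShortComplex.moduleCat_exact_iff _).1
    ((antipodalCover n).exact_transferMap_δ (R := ZMod 2) k (k + 1) rfl) x hx
  change (antipodalCover n).transferMap k y = 0
  rcases Nat.eq_zero_or_pos k with rfl | hk0
  · exact transferMap_zero_apply n hn y
  · haveI := ModuleCat.subsingleton_of_isZero
      (isZero_singularCohomology_sphere_of_field (ZMod 2) (M := n) (k := k) (by omega) (by omega))
    rw [Subsingleton.elim y 0, map_zero]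

/-- **`Δ : Hᵏ(ℝℙⁿ) → Hᵏ⁺¹(ℝℙⁿ)` is surjective for `k + 1 < n`** (`Hᵏ⁺¹(𝕊ⁿ; 𝔽₂) = 0`).
[cite: HatcherAT2002, §2.B p. 174 and Cor. 2.14] -/
theorem transferδ_surjective {k : ℕ} (hk : k + 1 < n) :
    Function.Surjective ((antipodalCover n).transferδ (R := ZMod 2) k (k + 1) rfl) := by
  haveI : Fact (Nat.Prime 2) := ⟨Nat.prime_two⟩
  intro x
  haveI := ModuleCat.subsingleton_of_isZero
    (isZero_singularCohomology_sphere_of_field (ZMod 2) (M := n) (k := k + 1) (by omega) (by omega))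
  exact (ShortComplex.moduleCat_exact_iff _).1
    ((antipodalCover n).exact_δ_map (R := ZMod 2) k (k + 1) rfl) x (Subsingleton.elim _ _)

/-- **`H⁰(ℝℙⁿ; 𝔽₂) = {0, 1}`** (`n ≥ 1`; `ℝℙⁿ` is path connected). [cite: HatcherAT2002, §3.1 p. 199] -/
theorem eq_zero_or_eq_one_of_degree_zero (hn : 1 ≤ n)
    (x : singularCohomology (ZMod 2) (ZMod 2) (RealProjectiveSpace n) 0) :
    x = 0 ∨ x = singularCohomology.one (ZMod 2) (RealProjectiveSpace n) := by
  haveI := pathConnectedSpace n hn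
  set e := singularCohomologyZeroEquiv (ZMod 2) (ZMod 2) (RealProjectiveSpace n) with he
  have h1 : e (singularCohomology.one (ZMod 2) (RealProjectiveSpace n)) = 1 := by
    rw [singularCohomology.one, singularCohomologyZeroEquiv_π, singularCochainComplex.cocyclesZeroEquiv_apply,
      singularCochainComplex.iCocycles_mk]
    rfl
  have hx : e x = 0 ∨ e x = 1 := by
    generalize e x = a
    fin_cases a
    · exact Or.inl rfl
    · exact Or.inr rfl
  rcases hx with h | h
  · left; exact e.injective (by rw [h, map_zero])
  · right; exact e.injective (by rw [h, h1])

/-- **`Hᵏ(ℝℙⁿ; 𝔽₂) = {0, ωᵏ}` for `k < n`** (inductively from `H⁰ = {0,1}` along the surjections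
`Δ`). [cite: HatcherAT2002, Thm. 3.19] -/
theorem eq_zero_or_eq_omegaPow (hn : 1 ≤ n) {k : ℕ} (hk : k < n)
    (x : singularCohomology (ZMod 2) (ZMod 2) (RealProjectiveSpace n) k) :
    x = 0 ∨ x = omegaPow n k := by
  induction k with
  | zero => exact eq_zero_or_eq_one_of_degree_zero n hn x
  | succ k ih =>
    obtain ⟨y, rfl⟩ := transferδ_surjective n hk x
    rcases ih (by omega) y with rfl | rfl
    · left; exact map_zero (ConcreteCategory.hom ((antipodalCover n).transferδ (R := ZMod 2) k (k + 1) rfl))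
    · right; rfl

/-- **`ωᵏ ≠ 0` for `k ≤ n`** (`n ≥ 1`): `1 ≠ 0` and `Δ` is injective below the top degree.
[cite: HatcherAT2002, Thm. 3.19] -/
theorem omegaPow_ne_zero (hn : 1 ≤ n) {k : ℕ} (hk : k ≤ n) : omegaPow n k ≠ 0 := by
  induction k with
  | zero =>
    haveI := pathConnectedSpace n hn
    intro h
    have h1 : singularCohomologyZeroEquiv (ZMod 2) (ZMod 2) (RealProjectiveSpace n)
        (singularCohomology.one (ZMod 2) (RealProjectiveSpace n)) = 1 := by
      rw [singularCohomology.one, singularCohomologyZeroEquiv_π, singularCochainComplex.cocyclesZeroEquiv_apply,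
        singularCochainComplex.iCocycles_mk]
      rfl
    rw [omegaPow_zero] at h
    rw [h, map_zero] at h1
    exact zero_ne_one h1
  | succ k ih =>
    intro h
    refine ih (by omega) (transferδ_injective n hn (k := k) (by omega) ?_)
    rw [← omegaPow_succ, h]
    exact (map_zero (ConcreteCategory.hom ((antipodalCover n).transferδ (R := ZMod 2) k (k + 1) rfl))).symm

/-! ### The top power pairs nontrivially with the fundamental class -/

/-- **Every class of `Hₙ(X; 𝔽₂)` of a closed connected `n`-manifold is a multiple of `[X]₂`**
(`Hₙ(X) → Hₙ(X | x) ≅ 𝔽₂` is an isomorphism carrying `[X]₂` to the generator; Hatcher 2002,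
Thm. 3.26(a),(b)). [cite: HatcherAT2002, Thm. 3.26] -/
theorem _root_.Literature.AlgebraicTopology.SingularHomology.exists_eq_smul_modTwoFundamentalClass
    {X : Type} [TopologicalSpace X] [T2Space X] [CompactSpace X] [ConnectedSpace X] {m : ℕ}
    [ChartedSpace (EuclideanSpace ℝ (Fin m)) X] (z : singularHomology (ZMod 2) (ZMod 2) X m) :
    ∃ a : ZMod 2, z = a • modTwoFundamentalClass X m := by
  obtain ⟨x⟩ := (inferInstance : Nonempty X)
  haveI := singularHomology.isIso_toLocal_of_orientation (modTwoOrientation X m) x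
  obtain ⟨e, he⟩ := (modTwoOrientation X m).isGenerator x
  have hfund := isFundamentalClass_modTwoFundamentalClass X m x
  refine ⟨e (singularHomology.toLocal (ZMod 2) (ZMod 2) x m z), ?_⟩
  apply ((ConcreteCategory.isIso_iff_bijective (singularHomology.toLocal (ZMod 2) (ZMod 2) x m)).1
    inferInstance).1
  apply e.injective
  rw [map_smul, map_smul, smul_eq_mul]
  change _ = _ * e (singularHomology.toLocal (ZMod 2) (ZMod 2) x m (modTwoFundamentalClass X m))
  rw [hfund, he, mul_one]

/-- **A top-degree class pairing to zero with `[X]₂` vanishes** (closed connected `n`-manifold,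
`𝔽₂` coefficients: `Hⁿ ≅ Hom(Hₙ, 𝔽₂)` and `Hₙ = 𝔽₂ · [X]₂`). [cite: HatcherAT2002, Thm. 3.26 and Thm. 3.2] -/
theorem _root_.Literature.AlgebraicTopology.SingularHomology.eq_zero_of_kroneckerPairing_modTwoFundamentalClass_eq_zero
    {X : Type} [TopologicalSpace X] [T2Space X] [CompactSpace X] [ConnectedSpace X] {m : ℕ}
    [ChartedSpace (EuclideanSpace ℝ (Fin m)) X] {y : singularCohomology (ZMod 2) (ZMod 2) X m}
    (hy : kroneckerPairing (ZMod 2) (ZMod 2) X m y (modTwoFundamentalClass X m) = 0) : y = 0 := by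
  haveI : Fact (Nat.Prime 2) := ⟨Nat.prime_two⟩
  apply (kroneckerPairing_bijective_of_field (ZMod 2) X m).1
  rw [map_zero]
  ext z
  obtain ⟨a, rfl⟩ := exists_eq_smul_modTwoFundamentalClass z
  rw [map_smul, hy, smul_zero, LinearMap.zero_apply]

/-- **`⟨ωⁿ, [ℝℙⁿ]₂⟩ ≠ 0`** (`n ≥ 1`): `ωⁿ ≠ 0` and the Kronecker pairing with the mod-2
fundamental class detects `Hⁿ(ℝℙⁿ; 𝔽₂)` (Hatcher 2002, Thm. 3.19: `H*(ℝℙⁿ; ℤ₂) ≅ ℤ₂[α]/(αⁿ⁺¹)`).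
[cite: HatcherAT2002, Thm. 3.19] -/
theorem kroneckerPairing_omegaPow_top_ne_zero (hn : 1 ≤ n) :
    kroneckerPairing (ZMod 2) (ZMod 2) (RealProjectiveSpace n) n (omegaPow n n)
      (modTwoFundamentalClass (RealProjectiveSpace n) n) ≠ 0 := by
  haveI := pathConnectedSpace n hn
  intro h
  exact omegaPow_ne_zero n hn le_rfl (eq_zero_of_kroneckerPairing_modTwoFundamentalClass_eq_zero h)

end Transfer

end RealProjectiveSpace

end Literature.Topology.FourManifolds
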